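import Mathlib
import Summits.Ventures.PercRepro2.Defs
import Summits.Ventures.PercRepro2.Harris
import Summits.Ventures.PercRepro2.Graph
import Summits.Ventures.PercRepro2.Events
import Summits.Ventures.PercRepro2.DisagreementPinned

/-!
# Row 2′CD from the quasi-concavity of its slack in every edge weight — the one-edge reduction
(blind cell PercRepro2, mine-a g31; MINE-A.md §86.3, §86.6, §86.10)

Two roots `a₁, a₂`, marks `a₃, o`; `Q = {a₁ ↮ a₂}`, `U = {C₁ ∈ 𝓔}` (`𝓔` a family of vertex sets),
`e = {a₃ ∈ C₁}`, `f = {o ∈ C₂}`, `N = {a₃ ∉ C₁ ∪ C₂}`, `oU = {o ∈ C₁ ∪ C₂}`.  The (CD)-slack of the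
weight vector `p` is

  `cdSlack p = γ · Cov_Q(U, e) − Cov_Q(U, e f)`,   `γ = P_Q(oU ∣ N)`,

written as `cdCleared p / (P(Q)² · P(Q ∩ N))` with the cleared form
`cdCleared p = P(Q N oU)·(P(Q)P(QUe) − P(QU)P(Qe)) − P(Q N)·(P(Q)P(QUef) − P(QU)P(Qef))`; row 2′CD for
`p` and `𝓔` is `0 ≤ cdSlack p` (equivalently `0 ≤ cdCleared p`).

**Quasi-concavity in every edge weight** (`QuasiConcaveCD`, a CANDIDATE of this seat — census: the
D-world form 122,210 / 122,210 steps along explorations of `C₂` and 0 failures on random pinning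
patterns, the Q-world form 1,323 / 1,323, kit j307087 / j307140 in flight; the CHORD form
`cdSlack p ≥ θ·cdSlack p[g↦1] + (1−θ)·cdSlack p[g↦0]` is FALSE, 30 / 122,210):

  `min (cdSlack p[g↦1]) (cdSlack p[g↦0]) ≤ cdSlack p`   for every admissible `p` and every edge `g`,

where `p[g↦c]` pins the edge `g` to `c`.  THE REDUCTION (`cdSlack_nonneg_of_quasiConcave`,
`cdCleared_nonneg_of_quasiConcave`): quasi-concavity implies the row for every weight vector, by strong
induction on the number of fractional edges — pin any fractional edge, the slack is at least the smaller
child's, and a fully pinned weight vector is a point mass, where every covariance and hence the slack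
vanishes (`cdCleared_pinned`).  So the row is exactly «revealing one edge never pushes the slack below
both outcomes».  Nothing about `QuasiConcaveCD` itself is claimed here.  One seat.
-/

namespace Summit.Ventures.PercRepro2

namespace CDQC

section Pinned

variable {E : Type*} [Fintype E] [DecidableEq E] {R : Type*} [Field R] [LinearOrder R]
  [IsStrictOrderedRing R]

omit [IsStrictOrderedRing R] in
/-- Under a fully pinned weight vector the weight is the point mass at the pinned configuration. -/
lemma weight_pinned_eq (q : E → R) (hq : ∀ f, q f = 0 ∨ q f = 1) (x : Config E) :
    weight q x = if x = pinnedConfig q then 1 else 0 := by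
  rw [weight_eq_of_pinned q ∅ (fun f _ => hq f) x, Finset.prod_empty, one_mul]
  by_cases hx : x = pinnedConfig q
  · rw [if_pos hx, if_pos (fun e _ => by rw [hx])]
  · rw [if_neg hx, if_neg]
    intro h
    exact hx (funext fun e => h e (Finset.notMem_empty e))

omit [IsStrictOrderedRing R] in
/-- Under a fully pinned weight vector the probability of an event is the indicator of the pinned
configuration. -/
lemma prob_pinned_eq (q : E → R) (hq : ∀ f, q f = 0 ∨ q f = 1) (A : Set (Config E)) :
    prob q A = A.indicator (fun _ => (1 : R)) (pinnedConfig q) := by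
  classical
  unfold prob
  have h : ∀ x : Config E, A.indicator (weight q) x =
      if x = pinnedConfig q then A.indicator (fun _ => (1 : R)) (pinnedConfig q) else 0 := by
    intro x
    by_cases hx : x = pinnedConfig q
    · rw [if_pos hx, hx]
      by_cases hA : pinnedConfig q ∈ A
      · rw [Set.indicator_of_mem hA, Set.indicator_of_mem hA, weight_pinned_eq q hq, if_pos rfl]
      · rw [Set.indicator_of_notMem hA, Set.indicator_of_notMem hA]
    · rw [if_neg hx]
      by_cases hA : x ∈ A
      · rw [Set.indicator_of_mem hA, weight_pinned_eq q hq, if_neg hx]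
      · rw [Set.indicator_of_notMem hA]
  simp_rw [h]
  rw [Finset.sum_ite_eq' Finset.univ (pinnedConfig q)]
  simp only [Finset.mem_univ, if_true]

omit [IsStrictOrderedRing R] in
/-- Under a fully pinned weight vector probabilities multiply as indicators:
`P(A) · P(B) = P(A ∩ B)`. -/
lemma prob_mul_prob_pinned (q : E → R) (hq : ∀ f, q f = 0 ∨ q f = 1) (A B : Set (Config E)) :
    prob q A * prob q B = prob q (A ∩ B) := by
  rw [prob_pinned_eq q hq, prob_pinned_eq q hq, prob_pinned_eq q hq]
  by_cases hA : pinnedConfig q ∈ A <;> by_cases hB : pinnedConfig q ∈ B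
  · rw [Set.indicator_of_mem hA, Set.indicator_of_mem hB, Set.indicator_of_mem (Set.mem_inter hA hB),
      one_mul]
  · rw [Set.indicator_of_notMem hB,
      Set.indicator_of_notMem (fun h => hB (Set.mem_of_mem_inter_right h)), mul_zero]
  · rw [Set.indicator_of_notMem hA,
      Set.indicator_of_notMem (fun h => hA (Set.mem_of_mem_inter_left h)), zero_mul]
  · rw [Set.indicator_of_notMem hA,
      Set.indicator_of_notMem (fun h => hA (Set.mem_of_mem_inter_left h)), zero_mul]

end Pinned

section Slack

variable {V : Type*} {E : Type*} [Fintype E] [DecidableEq E] [Fintype V] [DecidableEq V]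
  {R : Type*} [Field R] [LinearOrder R] [IsStrictOrderedRing R]

/-- The cleared form of row 2′CD:
`P(Q N oU)·(P(Q)P(QUe) − P(QU)P(Qe)) − P(Q N)·(P(Q)P(QUef) − P(QU)P(Qef))`
(`= P(Q)²·P(Q N)·(γ·Cov_Q(U, e) − Cov_Q(U, e f))`). -/
noncomputable def cdCleared (p : E → R) (ends : E → Sym2 V) (a₁ a₂ a₃ o : V) (𝓔 : Set (Set V)) : R :=
  let Q := (connEvent ends a₁ a₂)ᶜ
  let U := clusterInEvent ends a₁ 𝓔
  let e := connEvent ends a₁ a₃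
  let f := connEvent ends a₂ o
  let N := (connEvent ends a₁ a₃)ᶜ ∩ (connEvent ends a₂ a₃)ᶜ
  let oU := connEvent ends a₁ o ∪ connEvent ends a₂ o
  prob p (Q ∩ N ∩ oU) * (prob p Q * prob p (Q ∩ U ∩ e) - prob p (Q ∩ U) * prob p (Q ∩ e)) -
    prob p (Q ∩ N) * (prob p Q * prob p (Q ∩ U ∩ e ∩ f) - prob p (Q ∩ U) * prob p (Q ∩ e ∩ f))

/-- The (CD)-slack `γ·Cov_Q(U, e) − Cov_Q(U, e f)` (`0` when `P(Q)² · P(Q ∩ N) = 0`). -/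
noncomputable def cdSlack (p : E → R) (ends : E → Sym2 V) (a₁ a₂ a₃ o : V) (𝓔 : Set (Set V)) : R :=
  cdCleared p ends a₁ a₂ a₃ o 𝓔 /
    (prob p (connEvent ends a₁ a₂)ᶜ ^ 2 *
      prob p ((connEvent ends a₁ a₂)ᶜ ∩ ((connEvent ends a₁ a₃)ᶜ ∩ (connEvent ends a₂ a₃)ᶜ)))

/-- **Quasi-concavity of the (CD)-slack in every edge weight** (CANDIDATE, this seat): pinning any
edge `g` open or closed cannot push the slack below both outcomes. -/
def QuasiConcaveCD (ends : E → Sym2 V) (a₁ a₂ a₃ o : V) (𝓔 : Set (Set V)) : Prop :=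
  ∀ p : E → R, IsProbVec p → ∀ g : E,
    min (cdSlack (Function.update p g 1) ends a₁ a₂ a₃ o 𝓔)
        (cdSlack (Function.update p g 0) ends a₁ a₂ a₃ o 𝓔) ≤ cdSlack p ends a₁ a₂ a₃ o 𝓔

omit [Fintype V] [DecidableEq V] [IsStrictOrderedRing R] in
/-- Under a fully pinned weight vector the cleared slack vanishes (every covariance of a point mass
is zero). -/
lemma cdCleared_pinned (q : E → R) (hq : ∀ f, q f = 0 ∨ q f = 1) (ends : E → Sym2 V)
    (a₁ a₂ a₃ o : V) (𝓔 : Set (Set V)) : cdCleared q ends a₁ a₂ a₃ o 𝓔 = 0 := by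
  unfold cdCleared
  simp only
  set Q := (connEvent ends a₁ a₂)ᶜ with hQ
  set U := clusterInEvent ends a₁ 𝓔 with hU
  set e := connEvent ends a₁ a₃ with he
  set f := connEvent ends a₂ o with hf
  rw [prob_mul_prob_pinned q hq Q (Q ∩ U ∩ e), prob_mul_prob_pinned q hq (Q ∩ U) (Q ∩ e),
    prob_mul_prob_pinned q hq Q (Q ∩ U ∩ e ∩ f), prob_mul_prob_pinned q hq (Q ∩ U) (Q ∩ e ∩ f)]
  have s1 : Q ∩ (Q ∩ U ∩ e) = Q ∩ U ∩ (Q ∩ e) := by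
    ext ω; simp only [Set.mem_inter_iff]; tauto
  have s2 : Q ∩ (Q ∩ U ∩ e ∩ f) = Q ∩ U ∩ (Q ∩ e ∩ f) := by
    ext ω; simp only [Set.mem_inter_iff]; tauto
  rw [s1, s2]
  ring

omit [Fintype V] [DecidableEq V] [IsStrictOrderedRing R] in
/-- Under a fully pinned weight vector the slack vanishes. -/
lemma cdSlack_pinned (q : E → R) (hq : ∀ f, q f = 0 ∨ q f = 1) (ends : E → Sym2 V)
    (a₁ a₂ a₃ o : V) (𝓔 : Set (Set V)) : cdSlack q ends a₁ a₂ a₃ o 𝓔 = 0 := by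
  unfold cdSlack
  rw [cdCleared_pinned q hq, zero_div]

/-- The fractional edges of a weight vector. -/
noncomputable def fracEdges (p : E → R) : Finset E :=
  Finset.univ.filter fun f => ¬ (p f = 0 ∨ p f = 1)

omit [Fintype V] [DecidableEq V] [IsStrictOrderedRing R] in
/-- Pinning an edge removes it from the fractional edges. -/
lemma fracEdges_update (p : E → R) (g : E) {c : R} (hc : c = 0 ∨ c = 1) :
    fracEdges (Function.update p g c) = (fracEdges p).erase g := by
  ext f
  simp only [fracEdges, Finset.mem_filter, Finset.mem_univ, true_and, Finset.mem_erase]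
  by_cases hf : f = g
  · subst hf
    simp [hc]
  · simp [hf]

omit [Fintype V] [DecidableEq V] [IsStrictOrderedRing R] in
/-- Pinning a fractional edge lowers the number of fractional edges by one. -/
lemma card_fracEdges_update (p : E → R) {g : E} (hg : g ∈ fracEdges p) {c : R}
    (hc : c = 0 ∨ c = 1) :
    (fracEdges (Function.update p g c)).card = (fracEdges p).card - 1 := by
  rw [fracEdges_update p g hc, Finset.card_erase_of_mem hg]

omit [Fintype V] [DecidableEq V] in
/-- **THE REDUCTION**: quasi-concavity of the slack in every edge weight implies `0 ≤ cdSlack p`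
for every admissible weight vector (strong induction on the number of fractional edges; the fully
pinned base is a point mass with zero slack). -/
theorem cdSlack_nonneg_of_quasiConcave (ends : E → Sym2 V) (a₁ a₂ a₃ o : V) (𝓔 : Set (Set V))
    (hqc : QuasiConcaveCD (R := R) ends a₁ a₂ a₃ o 𝓔) :
    ∀ p : E → R, IsProbVec p → 0 ≤ cdSlack p ends a₁ a₂ a₃ o 𝓔 := by
  intro p hp
  generalize hn : (fracEdges p).card = n
  induction n using Nat.strong_induction_on generalizing p with
  | _ n ih =>
    by_cases h0 : fracEdges p = ∅
    · -- base: every edge is pinned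
      have hq : ∀ f, p f = 0 ∨ p f = 1 := by
        intro f
        by_contra hcon
        have : f ∈ fracEdges p := by
          simp only [fracEdges, Finset.mem_filter, Finset.mem_univ, true_and]
          exact hcon
        rw [h0] at this
        exact absurd this (Finset.notMem_empty f)
      rw [cdSlack_pinned p hq]
    · -- step: pin a fractional edge `g`
      obtain ⟨g, hg⟩ := Finset.nonempty_iff_ne_empty.mpr h0
      have hpos : 0 < n := by
        rw [← hn]
        exact Finset.card_pos.mpr ⟨g, hg⟩
      have hc1 : (fracEdges (Function.update p g (1 : R))).card = n - 1 := by
        rw [card_fracEdges_update p hg (Or.inr rfl), hn]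
      have hc0 : (fracEdges (Function.update p g (0 : R))).card = n - 1 := by
        rw [card_fracEdges_update p hg (Or.inl rfl), hn]
      have h1 : 0 ≤ cdSlack (Function.update p g 1) ends a₁ a₂ a₃ o 𝓔 :=
        ih (n - 1) (Nat.sub_lt hpos Nat.one_pos) (Function.update p g 1)
          (hp.update g zero_le_one le_rfl) hc1
      have h2 : 0 ≤ cdSlack (Function.update p g 0) ends a₁ a₂ a₃ o 𝓔 :=
        ih (n - 1) (Nat.sub_lt hpos Nat.one_pos) (Function.update p g 0)
          (hp.update g le_rfl zero_le_one) hc0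
      exact (le_min h1 h2).trans (hqc p hp g)

omit [Fintype V] [DecidableEq V] in
/-- **THE REDUCTION, cleared form**: quasi-concavity implies row 2′CD in cleared form,
`P(Q N)·(P(Q)P(QUef) − P(QU)P(Qef)) ≤ P(Q N oU)·(P(Q)P(QUe) − P(QU)P(Qe))`, for every admissible
weight vector. -/
theorem cdCleared_nonneg_of_quasiConcave (ends : E → Sym2 V) (a₁ a₂ a₃ o : V) (𝓔 : Set (Set V))
    (hqc : QuasiConcaveCD (R := R) ends a₁ a₂ a₃ o 𝓔) (p : E → R) (hp : IsProbVec p) :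
    0 ≤ cdCleared p ends a₁ a₂ a₃ o 𝓔 := by
  have h := cdSlack_nonneg_of_quasiConcave ends a₁ a₂ a₃ o 𝓔 hqc p hp
  unfold cdSlack at h
  set Q := (connEvent ends a₁ a₂)ᶜ with hQ
  set Nv := (connEvent ends a₁ a₃)ᶜ ∩ (connEvent ends a₂ a₃)ᶜ with hN
  set den := prob p Q ^ 2 * prob p (Q ∩ Nv) with hden
  have hden0 : 0 ≤ den := mul_nonneg (pow_nonneg (prob_nonneg hp _) 2) (prob_nonneg hp _)
  rcases hden0.lt_or_eq with hpos | hzero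
  · have := mul_nonneg h hpos.le
    rwa [div_mul_cancel₀ _ hpos.ne'] at this
  · -- the denominator vanishes: `P(Q) = 0` or `P(Q ∩ N) = 0`, and then every term of the
    -- cleared form is zero
    have hQN : prob p (Q ∩ Nv) = 0 ∨ prob p Q = 0 := by
      rcases mul_eq_zero.mp hzero.symm with h' | h'
      · exact Or.inr (pow_eq_zero_iff (n := 2) (by norm_num) |>.mp h')
      · exact Or.inl h'
    unfold cdCleared
    simp only
    have hmono : ∀ A : Set (Config E), A ⊆ Q ∩ Nv → prob p A = 0 := by
      intro A hA
      rcases hQN with h' | h'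
      · exact le_antisymm ((prob_mono hp hA).trans h'.le) (prob_nonneg hp A)
      · exact le_antisymm ((prob_mono hp (hA.trans Set.inter_subset_left)).trans h'.le)
          (prob_nonneg hp A)
    rw [hmono (Q ∩ Nv ∩ (connEvent ends a₁ o ∪ connEvent ends a₂ o)) Set.inter_subset_left,
      hmono (Q ∩ Nv) le_rfl]
    simp

end Slack

end CDQC

end Summit.Ventures.PercRepro2

/-!
## Erratum (mine-a g31, 2026-08-28T11:4xZ; MINE-A.md §86.12)

The hypothesis `QuasiConcaveCD` above — quasi-concavity of the slack in EVERY edge weight — is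
FALSE: on random partially pinned instances the Q-world slack fails it once in 97,348 steps (kit
j307280; witness: five vertices, edges `(0,1),(0,2),(0,3),(0,4),(1,2),(1,3),(1,4),(2,3),(2,4),(3,4)`
with weights `127/128, 1/128, 2/3, 1/3, 1/8, 3/4, 1/3, 1/8, 2/3, 1/4`, `a₁ = 0, a₂ = 1, a₃ = 3, o = 4`,
`𝓔 = {S ⊇ {3,4}} ∪ {S ⊇ {2,4}}`, the edge `(2,4)` — an edge not incident to the explored set of `a₂`),
and the D-world slack fails it twice (kit j307087).  The reduction theorems above are correct as
stated (they are implications); the census-backed candidate is the BOUNDARY form — quasi-concavity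
only in the weights of the fractional edges touching the explored set of `a₂` (0 failures in 174,000
boundary steps) — typed and reduced in `CDQuasiConcaveBoundary.lean` (`QuasiConcaveCDBoundary`,
`cdCleared_nonneg_of_quasiConcaveBoundary`).  The point-mass lemmas and the cleared form of this
file are what that file builds on.
-/
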